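import Summits.Ventures.HSemireg.WedgeHankelRecurrenceGaussRecurrenceCoprime

/-!
# Venture HSemireg — **GEGENBAUER NODES VERSUS SECOND-KIND GAUSS–CHEBYSHEV NODES, UNIFORMLY IN THE DEGREE AND QUANTITATIVELY IN `λ`**: the monic Gegenbauer recurrence has
# `b_{n+1}(λ) − 1∕4 = λ(1−λ)∕(4(n+λ)(n+1+λ))` (so `0 ≤ b − 1∕4 ≤ (1−λ)∕(4(1+λ))` for `0 < λ ≤ 1`, telescoping sum `Σ_{n<t} (b_{n+1} − 1∕4) = ((1−λ)∕4)(1 − λ∕(t+λ)) ≤ (1−λ)∕4`), the `U`-recurrence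
# is `λ = 1`; Hoffman–Wielandt (N417) gives for EVERY `t` and the increasing zeros `x` of `C^{(λ)}_{t+1}`: **`Σ_{k≤t} (cos((k'+1)π∕(t+2)) − x_k)² ≤ (1−λ)²∕(8(1+λ))`** — for `λ = ½` (Legendre)
# this is N436's `1∕48`

HONEST FRAMING. Part of the Lean index of the computation cell `pub-hsemireg` (seat p10 gen 47, Sunday typer «UNIFORM-IN-n»).  Real finite sums, `Real.cos`, `Real.sqrt` only; no variety, no
cohomology theory, no sheaf, no Ext group and no semiregularity map is constructed here; nothing here says that HC / HC_CM / HC_AV holds; no Literature fact (unproved `Prop`) is declared or used.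
Custodian versions as in `WedgeHankelSiegelIdeal` (1/3).
SOURCES (cited).  A. J. Hoffman, H. W. Wielandt, Duke Math. J. 20 (1953) 37–39; G. H. Golub, J. H. Welsch, Math. Comp. 23 (1969) 221–230; W. Gautschi, *Orthogonal Polynomials: Computation and
Approximation* (2004), §3.1; G. Szegő, *Orthogonal Polynomials*, (4.7.17) (Gegenbauer recurrence), §6.21 (monotonicity of the zeros in `λ`).  The uniform bound is the COROLLARY typed here of N417.
PROOF TYPED HERE.  N417 `hoffman_wielandt_recurrence`; §1125 Chebyshev-`U` recurrence facts; the scalar estimates `(√(1∕4) − √u)² ≤ (u − 1∕4)²` (`u ≥ 1∕4`), `b − 1∕4 = λ(1−λ)∕(4(n+λ)(n+1+λ))`, and the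
telescoping sum `Σ_{n<t} 1∕((n+λ)(n+1+λ)) = 1∕λ − 1∕(t+λ)`.
DEDUP DISCLOSURE (`rg -n -i 'gegenbauer.*nodes_hoff|coeff_sub_quarter' Summits/Ventures/HSemireg`, 2026-09-04): N436 (the case `λ = ½`); 0 hits for the 5 names below.

WHAT IS IN THE TREE.  N417 `hoffman_wielandt_recurrence`; N436 `legendre_chebyshevU_nodes_hoffman_wielandt`; §1155 `gegenbauer_zeros` (existence of the increasing zeros in `(−1,1)`).
THIS FILE (namespace `Summit.Ventures.HSemireg.Wedge.HankelOuter` continued; CHAINED on N447; 0 definitions):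
* §1213 `sqrt_quarter_sub_sqrt_sq_le`, `gegenbauer_coeff_sub_quarter`, `sum_inv_mul_succ_shift`, **`gegenbauer_chebyshevU_nodes_hoffman_wielandt`** (`≤ (1−λ)²∕(8(1+λ))`),
  `gegenbauer_chebyshevU_nodes_sub_sq_le` (each pair: `(y_k − x_k)² ≤ (1−λ)²∕(8(1+λ))`).
CAVEATS.  `0 < λ ≤ 1` (for `λ > 1` the couplings lie below `1∕4` and the same method works with `|b − 1∕4|`; not typed).  The Gegenbauer zeros enter as any increasing `x` with the product representation.
Nothing Ext-side.  New names only.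
-/

open Module Polynomial Real
open scoped Matrix Polynomial

namespace Summit.Ventures.HSemireg.Wedge.HankelOuter

/-! ## §1213. Gegenbauer versus second-kind Chebyshev nodes -/

/-- `(√(1∕4) − √u)² ≤ (u − 1∕4)²` for `u ≥ 1∕4` (`|√u − ½| = |u − ¼|∕(√u + ½) ≤ |u − ¼|`). [bookkeeping; this file, §1213] -/
theorem sqrt_quarter_sub_sqrt_sq_le {u : ℝ} (hu : 1 / 4 ≤ u) : (Real.sqrt (1 / 4) - Real.sqrt u) ^ 2 ≤ (u - 1 / 4) ^ 2 := by
  have h4 : Real.sqrt (1 / 4) = 1 / 2 := by rw [show (1 / 4 : ℝ) = (1 / 2) ^ 2 by norm_num, Real.sqrt_sq (by norm_num)]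
  set s : ℝ := Real.sqrt u with hs
  have hs2 : s ^ 2 = u := Real.sq_sqrt (by linarith)
  have hhalf : 1 / 2 ≤ s := by
    rw [hs, Real.le_sqrt (by norm_num)]
    · linarith
    · linarith
  have h1 : (1 : ℝ) ≤ (s + 1 / 2) ^ 2 := by nlinarith
  rw [h4, ← hs2]
  calc (1 / 2 - s) ^ 2 = (s - 1 / 2) ^ 2 * 1 := by ring
    _ ≤ (s - 1 / 2) ^ 2 * (s + 1 / 2) ^ 2 := mul_le_mul_of_nonneg_left h1 (sq_nonneg _)
    _ = (s ^ 2 - 1 / 4) ^ 2 := by ring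

/-- **`b_{n+1}(λ) − 1∕4 = λ(1−λ)∕(4(n+λ)(n+1+λ))`** for the Gegenbauer couplings (`λ > 0`). [Szegő (4.7.17); this file, §1213] -/
theorem gegenbauer_coeff_sub_quarter {b : ℕ → ℝ} {lam : ℝ} (hb : ∀ n, b (n + 1) = ((n : ℝ) + 1) * ((n : ℝ) + 2 * lam) / (4 * ((n : ℝ) + 1 + lam) * ((n : ℝ) + lam))) (hlam : 0 < lam)
    (n : ℕ) : b (n + 1) - 1 / 4 = lam * (1 - lam) / (4 * ((n : ℝ) + lam) * ((n : ℝ) + 1 + lam)) := by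
  have h0 : (0 : ℝ) ≤ n := Nat.cast_nonneg n
  have h1 : ((n : ℝ) + 1 + lam) ≠ 0 := by positivity
  have h2 : ((n : ℝ) + lam) ≠ 0 := by positivity
  rw [hb, div_sub' (by positivity), div_eq_div_iff (by positivity) (by positivity)]
  ring

/-- `Σ_{n<t} 1∕((n+λ)(n+1+λ)) = 1∕λ − 1∕(t+λ)` (telescoping, `λ > 0`). [bookkeeping; this file, §1213] -/
theorem sum_inv_mul_succ_shift {lam : ℝ} (hlam : 0 < lam) (t : ℕ) :
    ∑ n ∈ Finset.range t, 1 / (((n : ℝ) + lam) * ((n : ℝ) + 1 + lam)) = 1 / lam - 1 / ((t : ℝ) + lam) := by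
  induction t with
  | zero => simp
  | succ t ih =>
    rw [Finset.sum_range_succ, ih]
    push_cast
    have h0 : (0 : ℝ) ≤ t := Nat.cast_nonneg t
    have h1 : ((t : ℝ) + lam) ≠ 0 := by positivity
    have h2 : ((t : ℝ) + 1 + lam) ≠ 0 := by positivity
    field_simp
    ring

/-- **`Σ_k (y_k − x_k)² ≤ (1−λ)²∕(8(1+λ))`** for the increasing zeros `x` of the Gegenbauer polynomial `C^{(λ)}_{t+1}` (`0 < λ ≤ 1`, chapter recurrence) and the increasing zeros `y` of `U_{t+1}`, every
`t`. [corollary of Hoffman–Wielandt 1953 via Golub–Welsch 1969; Gautschi §3.1; Szegő §6.21; this file, §1213] -/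
theorem gegenbauer_chebyshevU_nodes_hoffman_wielandt {q : ℕ → ℝ[X]} {a b : ℕ → ℝ} {lam : ℝ} (hq0 : q 0 = 1) (hq1 : q 1 = Polynomial.X - C (a 0))
    (hrec : ∀ n, q (n + 2) = (Polynomial.X - C (a (n + 1))) * q (n + 1) - C (b (n + 1)) * q n) (ha : ∀ n, a n = 0)
    (hb : ∀ n, b (n + 1) = ((n : ℝ) + 1) * ((n : ℝ) + 2 * lam) / (4 * ((n : ℝ) + 1 + lam) * ((n : ℝ) + lam))) (hlam : 0 < lam) (hlam1 : lam ≤ 1) (hb0 : 0 < b 0)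
    {t : ℕ} {x : Fin (t + 1) → ℝ} (hx : StrictMono x) (hxq : q (t + 1) = ∏ k, (Polynomial.X - C (x k))) :
    ∑ k, (cos ((((Fin.rev k : Fin (t + 1)) : ℝ) + 1) * π / ((t : ℝ) + 2)) - x k) ^ 2 ≤ (1 - lam) ^ 2 / (8 * (1 + lam)) := by
  obtain ⟨q', hq0', hq1', hrec'⟩ := recurrence_of_coefficients (fun _ => (0 : ℝ)) (fun _ => (1 / 4 : ℝ))
  have hyq := chebyshevU_recurrence_eq_prod (q := q') (a := fun _ => (0 : ℝ)) (b := fun _ => (1 / 4 : ℝ)) hq0' hq1' hrec' (fun _ => rfl) (fun _ => rfl) t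
  -- `0 ≤ b_{n+1} − 1/4 ≤ (1−λ)/(4(1+λ))`
  have hsub := gegenbauer_coeff_sub_quarter hb hlam
  have h1l : 0 ≤ 1 - lam := by linarith
  have hnum : 0 ≤ lam * (1 - lam) := mul_nonneg hlam.le h1l
  have hnn : ∀ n : ℕ, 0 ≤ b (n + 1) - 1 / 4 := fun n => by
    rw [hsub]
    have h0 : (0 : ℝ) ≤ n := Nat.cast_nonneg n
    exact div_nonneg hnum (by positivity)
  have hle : ∀ n : ℕ, b (n + 1) - 1 / 4 ≤ (1 - lam) / (4 * (1 + lam)) := fun n => by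
    rw [hsub]
    have h0 : (0 : ℝ) ≤ n := Nat.cast_nonneg n
    calc lam * (1 - lam) / (4 * ((n : ℝ) + lam) * ((n : ℝ) + 1 + lam)) ≤ lam * (1 - lam) / (4 * lam * (1 + lam)) :=
          div_le_div_of_nonneg_left hnum (by positivity) (by nlinarith)
      _ = (1 - lam) / (4 * (1 + lam)) := by field_simp
  have hbpos : ∀ j, 0 < b j := fun j => by
    rcases j with _ | n
    · exact hb0
    · linarith [hnn n]
  have h := hoffman_wielandt_recurrence (q := q) (q' := q') (a := a) (a' := fun _ => (0 : ℝ)) (b := b) (b' := fun _ => (1 / 4 : ℝ))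
    hq0 hq1 hrec hq0' hq1' hrec' hbpos (fun _ => by norm_num) hx hxq (chebyshevU_nodes_strictMono t) hyq
  refine h.trans ?_
  simp only [ha, sub_self, zero_pow two_ne_zero, Finset.sum_const_zero, zero_add]
  have ht : (0 : ℝ) ≤ t := Nat.cast_nonneg t
  -- the telescoped sum of `b − 1/4`
  have hsum : ∑ i ∈ Finset.range t, (b (i + 1) - 1 / 4) ≤ (1 - lam) / 4 := by
    rw [Finset.sum_congr rfl fun i _ => (hsub i).trans (show lam * (1 - lam) / (4 * ((i : ℝ) + lam) * ((i : ℝ) + 1 + lam)) =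
      lam * (1 - lam) / 4 * (1 / (((i : ℝ) + lam) * ((i : ℝ) + 1 + lam))) by
        have h0 : (0 : ℝ) ≤ i := Nat.cast_nonneg i
        field_simp), ← Finset.mul_sum, sum_inv_mul_succ_shift hlam t]
    have hpos : 0 ≤ 1 / ((t : ℝ) + lam) := by positivity
    have hfrac : 1 / lam - 1 / ((t : ℝ) + lam) ≤ 1 / lam := by linarith
    calc lam * (1 - lam) / 4 * (1 / lam - 1 / ((t : ℝ) + lam)) ≤ lam * (1 - lam) / 4 * (1 / lam) :=
          mul_le_mul_of_nonneg_left hfrac (div_nonneg hnum (by norm_num))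
      _ = (1 - lam) / 4 := by field_simp
  have hc : 0 ≤ (1 - lam) / (4 * (1 + lam)) := div_nonneg h1l (by positivity)
  calc 2 * ∑ i ∈ Finset.range t, (Real.sqrt (1 / 4) - Real.sqrt (b (i + 1))) ^ 2 ≤ 2 * ∑ i ∈ Finset.range t, (b (i + 1) - 1 / 4) ^ 2 := by
        refine mul_le_mul_of_nonneg_left (Finset.sum_le_sum fun i _ => ?_) (by norm_num)
        exact sqrt_quarter_sub_sqrt_sq_le (u := b (i + 1)) (by linarith [hnn i])
    _ ≤ 2 * ∑ i ∈ Finset.range t, ((1 - lam) / (4 * (1 + lam)) * (b (i + 1) - 1 / 4)) := by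
        refine mul_le_mul_of_nonneg_left (Finset.sum_le_sum fun i _ => ?_) (by norm_num)
        rw [sq]
        exact mul_le_mul_of_nonneg_right (hle i) (hnn i)
    _ = 2 * ((1 - lam) / (4 * (1 + lam)) * ∑ i ∈ Finset.range t, (b (i + 1) - 1 / 4)) := by rw [← Finset.mul_sum]
    _ ≤ 2 * ((1 - lam) / (4 * (1 + lam)) * ((1 - lam) / 4)) := mul_le_mul_of_nonneg_left (mul_le_mul_of_nonneg_left hsum hc) (by norm_num)
    _ = (1 - lam) ^ 2 / (8 * (1 + lam)) := by field_simp; ring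

/-- **Each increasing-ordered pair of Gegenbauer and second-kind Gauss–Chebyshev nodes: `(y_k − x_k)² ≤ (1−λ)²∕(8(1+λ))`**, uniformly in the degree. [corollary; this file, §1213] -/
theorem gegenbauer_chebyshevU_nodes_sub_sq_le {q : ℕ → ℝ[X]} {a b : ℕ → ℝ} {lam : ℝ} (hq0 : q 0 = 1) (hq1 : q 1 = Polynomial.X - C (a 0))
    (hrec : ∀ n, q (n + 2) = (Polynomial.X - C (a (n + 1))) * q (n + 1) - C (b (n + 1)) * q n) (ha : ∀ n, a n = 0)
    (hb : ∀ n, b (n + 1) = ((n : ℝ) + 1) * ((n : ℝ) + 2 * lam) / (4 * ((n : ℝ) + 1 + lam) * ((n : ℝ) + lam))) (hlam : 0 < lam) (hlam1 : lam ≤ 1) (hb0 : 0 < b 0)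
    {t : ℕ} {x : Fin (t + 1) → ℝ} (hx : StrictMono x) (hxq : q (t + 1) = ∏ k, (Polynomial.X - C (x k))) (k : Fin (t + 1)) :
    (cos ((((Fin.rev k : Fin (t + 1)) : ℝ) + 1) * π / ((t : ℝ) + 2)) - x k) ^ 2 ≤ (1 - lam) ^ 2 / (8 * (1 + lam)) :=
  (Finset.single_le_sum (f := fun k : Fin (t + 1) => (cos ((((Fin.rev k : Fin (t + 1)) : ℝ) + 1) * π / ((t : ℝ) + 2)) - x k) ^ 2) (fun _ _ => sq_nonneg _)
    (Finset.mem_univ k)).trans (gegenbauer_chebyshevU_nodes_hoffman_wielandt hq0 hq1 hrec ha hb hlam hlam1 hb0 hx hxq)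

end Summit.Ventures.HSemireg.Wedge.HankelOuter
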